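import Mathlib.Analysis.Complex.Basic
import Mathlib.Algebra.Group.Conj
import Mathlib.Algebra.Group.Subgroup.Defs
import Mathlib.Algebra.BigOperators.Finprod
import Mathlib.LinearAlgebra.Span.Defs
import Mathlib.Topology.Compactness.Compact
import Mathlib.Data.Quot
import HarnessLib

/-!
# Shelstad, *On geometric transfer in real twisted endoscopy* (Ann. of Math. 176, 2012) — §1 «Introduction» (the setting:
# `(θ, ϖ)`-twisting, z-pair `(H₁, ξ₁)`, `θ`-Schwartz functions, twisted orbital integrals, the transfer factor `Δ(γ₁, δ)`) and §2
# «Statement of the main theorem»: `Trans(f)`, `Trans_c(f)`, THEOREM 2.1 (Main Theorem), COROLLARY 2.2 and its printed proof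

Topic `NumberTheory/Automorphic/Shelstad2012`; namespace `Literature.NumberTheory.Automorphic.Shelstad2012.GeometricTransfer`.
STATEMENTS ONLY (a typing carpet): one `structure` (a data-only dictionary, no field asserts a proposition) and `def`s with bodies;
**no theorem, no proof, no `sorry`, no `axiom`, no `instance`, no `notation`**.  Source: D. Shelstad, *On geometric transfer in real
twisted endoscopy*, Ann. of Math. (2) **176** (2012) 1919–1985 [Shelstad2012], read on the held page-exact text
`paper:doi-10-4007-annals-2012-176-3-9` (file `pNNNN.txt` = printed page `1918 + NNNN`: p0002–p0006 = §1 pp. 1920–1924, p0006–p0008 =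
§2 pp. 1924–1926; p0018–p0020 = §5 pp. 1936–1938; p0059–p0060 = §11 pp. 1977–1978; p0063–p0064 = §12 pp. 1981–1982).  Every page pin
below is a PRINTED Annals page.

## What the consumers want, and the dress

The tree cites [Shelstad2012] in ★ `Rogawski1990.ArchBouazizReplacement` (the SCHEMA of the proof of Cor. 2.2), ★
`Rogawski1990.ArchInnerTransferOfSchwartzReplacement`, ★ `…ArchTransferSideBounded`, ★ `…ArchInnerTransferSideCompact`, ★
`…ArchEndoscopicEigenvalueBound`, ★ `…ArchEndoscopicEigenvalueCompact`, ★ `…ArchUnitaryPlaneEigenframeCompact`, ★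
`…ArchUnitaryThreeEigenframeCompact`, ★ `Automorphic.ArchSchwartzSpace`, ★ `RepresentationTheory.Bouaziz1994.OrbitalIntegralsCharacterisation`
and in the H413 lines `F0_P3c_StubN9Paydown` ∕ `F0_P3c_ArchInnerTransferPaydown` (organs `stub_N9schwartzTransfer`, `stub_N9bouazizReplacement`,
`stub_N8bouaziz`) for TWO things, always with the locator «Cor. 2.2 p. 1926» or «Thm. 2.1»: (a) the EXISTENCE of geometric transfer — a
Schwartz (THEOREM 2.1) resp. compactly supported (COROLLARY 2.2) `f₁` on `H₁(ℝ)` whose stable orbital integrals match the `Δ`-weighted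
twisted orbital integrals of `f`; (b) the two steps of the PRINTED PROOF of Cor. 2.2: «the stable orbital integrals of `f₁⁰` vanish off
the conjugacy classes meeting a set in `H₁(ℝ)` that is bounded modulo `Z₁(ℝ)`» and «Bouaziz's characterization of stable orbital
integrals of `C_c^∞`-functions shows that there exists `f₁ ∈ C_c^∞(H₁(ℝ), ϖ₁)` such that `SO(γ₁, f₁) = SO(γ₁, f₁⁰)` for all strongly
`G`-regular `γ₁`» ([Bou94, Th. 6.2.1] = ★ `Bouaziz1994.OrbitalIntegralsCharacterisation.Bouaziz1994_6_2_1_i_surjective`, with the «slight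
extension» [Ren03, §5.3]).  After this file they are citable BY NAME: `Shelstad2012_2_1_mainTheorem`, `Shelstad2012_2_2_compactSupport`,
`Shelstad2012_2_2_proof_boundedModCentre`, `Shelstad2012_2_2_proof_bouazizStep`.

Mathlib has no real reductive groups, no Harish-Chandra Schwartz space, no (twisted) orbital integrals, no endoscopic data and no
transfer factors.  As in the sibling carpets ★ `Shelstad1979.Correspondences` (`TemperedSetting`) and ★ `Shelstad1982.TransferAndLifting`
(`TransferSetting`), the objects print takes from [KS99] and from its own §1 and appendix are the FIELDS of an explicit data-only dictionary
`TwistedTransferSetting G H₁` (`G` = the real points `G(ℝ)`, `H₁` = `H₁(ℝ)`): `θ`, `ϖ`, `Z₁(ℝ)`, `ϖ₁`, the four function spaces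
`𝒞(G(ℝ), θ) ⊇ C_c^∞(G(ℝ), θ)` and `𝒞(H₁(ℝ), ϖ₁) ⊇ C_c^∞(H₁(ℝ), ϖ₁)`, «strongly `θ`-regular», «strongly `G`-regular», «`γ₁` is a norm of `δ`»,
`O^{θ,ϖ}(δ, f)`, `SO(γ₁, f₁)`, `Δ(γ₁, δ)`, and the stable tempered characters on `H₁(ℝ)`.  What print DEFINES in §§1–2 is a `def` with its
printed body over that dictionary: `θ`-conjugacy (`IsTwistedConj`, p. 1922 ∕ p. 1923), the `θ`-twisted centralizer (`twistedCentralizer`,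
p. 1922), the transformation law under `Z₁(ℝ)` (`IsVarpiEquivariant`, p. 1922), the `θ`-conjugacy classes of strongly `θ`-regular elements
(`TwistedClass`) and the right side `Σ_{δ, θ-conj} Δ(γ₁, δ) O^{θ,ϖ}(δ, f)` (`summandRep`, `deltaWeightedSum`, pp. 1924–1925), the matching
(`IsDeltaMatching`), `Trans(f)` (`transferSet`) and `Trans_c(f)` (`transferSetc`) (pp. 1924–1925), the annihilators of the stable tempered
characters (`stableAnnihilator`, `stableAnnihilatorc`, p. 1925), «bounded modulo `Z₁(ℝ)`» (`IsBoundedModCentre`) and «vanish off the conjugacy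
classes meeting a set» (`StOrbVanishOffClassesMeeting`, p. 1926).  **Every printed assertion is a `def … : Prop` PREDICATE on the
dictionary** (print's theorem = the predicate HOLDS for print's data; a consumer takes `(h : D.Shelstad2012_2_2_compactSupport)` for ITS
instantiation; `∀ D, …` is never claimed; no debt beyond the named rows is created).  The sum over `θ`-conjugacy classes is typed exactly
as the tree's untwisted transfer dress ★ `Rogawski1990.IsDeltaTransferRel` types `Σ_{γ} Δ(γ_H, γ) Φ(γ, f)`: a `finsum` over the class type
of the summand evaluated at a representative (`Quot.out`); print's «depends only on the `θ`-conjugacy class … and is nonvanishing on finitely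
many such classes» (p. 1925) is the named row `Shelstad2012_2_sumOverClasses`, which makes the representative immaterial and the `finsum` a sum.

**How COROLLARY 2.2 specialises to standard endoscopy (the untwisted case `θ` trivial).**  Print, p. 1920: «If `θ` is inner, then `θ*` is the
identity, and we have a slight variant of the setting for standard endoscopy [LS87, §1.3]»; p. 1923: «given the definitions of the transfer
factors in [LS87] and the alternate characterization of stable orbital integrals we use here …, the present paper offers a relatively short
proof of the transfer for standard endoscopy»; abstract p. 1919: «Our proof contains a relatively short self-contained argument for the already
known case of standard endoscopy.»  With `θ = 1` and `a_ϖ` (hence `ϖ`) trivial: `θ`-conjugacy is conjugacy, strongly `θ`-regular = strongly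
regular, `O^{θ,ϖ}(δ, f)` is the ordinary orbital integral, `𝒞(G(ℝ), θ) = 𝒞(G(ℝ))`; when an `L`-isomorphism `ξ¹ : ℋ → ᴸH` exists one may take the
z-pair `(H₁, ξ₁) = (H, ξ¹)`, so `Z₁ = 1`, `ϖ₁ = 1`, `𝒞(H₁(ℝ), ϖ₁) = 𝒞(H(ℝ))`, «`γ₁` is a norm of `δ`» = «`γ_H` is an image of `δ`» [LS87, (1.3)], and
`Δ(γ₁, δ)` is the transfer factor of [LS87] — by [LS90, Thm. 2.6.A] (★
`LanglandsShelstad1990Descent.Consequences.LanglandsShelstad1990Descent_2_6_A_archimedeanTransferFactor`) a constant multiple of Shelstad's real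
factor `Δ_(T,η)` (★ `Shelstad1982.TransferAndLifting.TransferSetting.shelstadDelta`).  THEOREM 2.1 then says: every `f ∈ 𝒞(G(ℝ))` has
`f^H ∈ 𝒞(H(ℝ))` with `Δ`-matching orbital integrals — print's [Shelstad1982] DEFINITION (3.1.1) + CONCLUSION (3.6), i.e. ★
`Shelstad1982.TransferAndLifting.TransferSetting.IsTransferFactorFamily` ∕ `….Shelstad1982_3_6_twoAttachedFamilies` (which index the `G`-side by
the pairs `(T, η) ∈ 𝒯_H(G)` and `κ`-orbital integrals `Φ^{(T,κ)}_f` rather than by the `Δ`-weighted sum over the conjugacy classes in a stable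
class — the two dresses of the same identity, [Shelstad1982, §3.1 p. 393] vs. p. 1924 here); COROLLARY 2.2 is its `C_c^∞` version «to obtain
`f^H` of compact support» that ★ `Rogawski1990` §4.9 Prop. 4.9.1 (a) p. 55 uses at the real place, and the proof of Cor. 2.2 is the road the H413
organs `stub_N9bouazizReplacement` ∕ `stub_N8bouaziz` formalise (Schwartz transfer + bounded support + Bouaziz).  Those tree statements are
CITED here, not restated.

## Index (print item ↦ declaration)

| print | declaration | kind |
|---|---|---|
| §1 pp. 1920–1923, §2 p. 1925, App. pp. 1982–1983: `θ`, `ϖ`, `Z₁(ℝ)`, `ϖ₁`, `𝒞(G(ℝ),θ)`, `C_c^∞(G(ℝ),θ)`, `𝒞(H₁(ℝ),ϖ₁)`, `C_c^∞(H₁(ℝ),ϖ₁)`, strongly `θ`-regular, strongly `G`-regular, norm, `O^{θ,ϖ}`, `SO`, `Δ`, stable tempered characters | `TwistedTransferSetting` | structure (data only) |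
| §1 p. 1922 «`xθ.g = g⁻¹ x θ(g) θ`», p. 1923 integrand `f(g⁻¹ δ θ(g))`, p. 1925 «`θ`-conjugacy classes» | `IsTwistedConj` | def |
| §1 p. 1922 `Cent_θ(δ, G)(ℝ)` | `twistedCentralizer` | def |
| §1 p. 1922 display `f₁(z₁h₁) = ϖ₁(z₁)⁻¹ f₁(h₁)` | `IsVarpiEquivariant` | def |
| §1 p. 1921 «`Z₁` … central», p. 1922 display, p. 1925 `C_c^∞(H₁(ℝ), ϖ₁)` | `Shelstad2012_1_zPairSpaces` | def (Prop) |
| §1 p. 1922 «Because `δ` has a norm in `H₁(ℝ)`, `ϖ` is trivial on `Cent_θ(δ, G)(ℝ)`» | `Shelstad2012_1_varpiTrivialOnTwistedCentralizer` | def (Prop) |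
| §2 p. 1925 «`θ`-conjugacy classes of strongly `θ`-regular elements in `G(ℝ)`» | `TwistedClass` | def (Type) |
| §2 pp. 1924–1925 `Σ_{δ, θ-conj} Δ(γ₁, δ) O^{θ,ϖ}(δ, f)` | `summandRep`, `deltaWeightedSum` | def |
| §2 p. 1925 «depends only on the `θ`-conjugacy class … nonvanishing on finitely many such classes (see Section 5)» | `Shelstad2012_2_sumOverClasses` | def (Prop) |
| §5 pp. 1937–1938 «contribution of the class of `δ` … zero if `γ₁` is not a norm of `δ`», «the (finite) set of `θ`-conjugacy classes in this stable class» | `Shelstad2012_5_sumOverNormClasses` | def (Prop) |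
| §2 pp. 1924–1925 the matching identity, `Trans(f)`, `Trans_c(f)` | `IsDeltaMatching`, `transferSet`, `transferSetc` | def |
| §2 p. 1925 «Embedding `C_c^∞(G(ℝ), θ)` in `𝒞(G(ℝ), θ)`» (and `C_c^∞(H₁(ℝ),ϖ₁) ⊆ 𝒞(H₁(ℝ),ϖ₁)`) | `Shelstad2012_2_testFunctionsEmbed` | def (Prop) |
| §2 p. 1925 «if strongly `G`-regular `γ₁` is not a norm, then … `Δ(γ₁, δ) = 0` for all strongly `θ`-regular `δ`» | `Shelstad2012_2_deltaZeroOffNorms` | def (Prop) |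
| §2 p. 1925 annihilator of the stable tempered characters in `𝒞(H₁(ℝ),ϖ₁)` ∕ in `C_c^∞(H₁(ℝ),ϖ₁)` | `stableAnnihilator`, `stableAnnihilatorc` | def |
| §2 p. 1925 «`f₁ ∈ Trans(f)` is determined uniquely modulo the annihilator …» (both versions) | `Shelstad2012_2_transferUniqueModAnnihilator` | def (Prop) |
| §2 THEOREM 2.1 (Main Theorem) (p. 1925) | `Shelstad2012_2_1_mainTheorem` | def (Prop) |
| §2 COROLLARY 2.2 (p. 1926) | `Shelstad2012_2_2_compactSupport` | def (Prop) |
| §2 proof of Cor. 2.2 (p. 1926): «bounded modulo `Z₁(ℝ)`», «vanish off the conjugacy classes meeting a set» | `IsBoundedModCentre`, `StOrbVanishOffClassesMeeting` | def |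
| §2 proof of Cor. 2.2 (p. 1926), step 1 | `Shelstad2012_2_2_proof_boundedModCentre` | def (Prop) |
| §2 proof of Cor. 2.2 (p. 1926), step 2 ([Bou94, Th. 6.2.1]; [Ren03, §5.3]) | `Shelstad2012_2_2_proof_bouazizStep` | def (Prop) |

NOT typed here (census): §1 p. 1923 «the relative factor `Δ(γ₁, δ)/Δ(γ̄₁, δ̄)` … is canonical [KS99, Th. 4.6.A]» (a statement about [KS99]'s
definition, whose terms `Δ_I … Δ_IV` are not carried); p. 1925 «The strongly `G`-regular elements are dense in the set of all regular semisimple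
elements in `H₁(ℝ)`» and the Harish-Chandra regularity argument (no regular-semisimple carrier here); p. 1926 the `K`-finite remarks («spectral
methods are expected to show …» is an expectation, not a theorem; the standard-case `K₁`-finite sentence rests on the spectral factors
`Δ(π₁, π)` of [She10], no consumer); THEOREM 4.2 ∕ THEOREM 5.1 ∕ LEMMA 9.3 (the limit formulas and the main lemma — proof internals, §§3–10);
THEOREM 12.1 (p. 1981, the characterization of stable orbital integrals on `G(ℝ)g₀` by Properties (I)–(IV), whose second sentence «If also `S`
vanishes off the orbits of some set `Z₁(ℝ)B`, where `B` is a bounded subset …, then `f` may be chosen in `C_c^∞(G(ℝ)g₀, ϖ₁)`» is, at `G = H₁`,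
`g₀ = 1` (p. 1977), print's own form of the «slight extension of [Bou94, Th. 6.2.1]» used in the proof of Cor. 2.2 — Properties (III)–(IV) need
the transforms `Ψ_{a,χ}` of §§3–10) and THEOREM 12.2 (p. 1982, Thm. 2.1 and Cor. 2.2 «remain true in the general setting of Section 6», i.e. for
slightly twisted norms in the coset `H₁(ℝ)h₁` — the §12 coset set-up is not carried; this file is print's setting of §§2–11: «Until Section 12
we assume that the norm correspondence involves no twisting of the conjugacy classes in `H₁(ℝ)`», p. 1924).  Haar measures (p. 1923 «compatible
measures `dt_δ` and `dt_{γ₁}`», §11 pp. 1977–1978) are absorbed in the fields `twOrb`, `stOrb`, as in ★ `Shelstad1979.Correspondences`.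
Dedup: no `Literature/…/Shelstad2012/` file before this one; `lean search` for `TwistedTransferSetting|TwistedClass|deltaWeightedSum|transferSet|
IsTwistedConj|stableAnnihilator|IsBoundedModCentre` = 0 declarations; the twisted-conjugacy predicates ★ `Morel2010Shimura.Ch8Sec1NonconnectedGroups.IsThetaConjugate`
(finite groups `Γ ⋊ ⟨θ⟩`) and ★ `Kottwitz1986BaseChangeUnits.MainResult.IsThetaConj` (`σ`-conjugacy for base change, `δ' = x⁻¹ δ σ^j(x)`) are different
carriers ∕ shapes and are cited, not reused.

## References
* [Shelstad2012] D. Shelstad, *On geometric transfer in real twisted endoscopy*, Ann. of Math. (2) 176 (2012) 1919–1985: §1 pp. 1919–1924, §2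
  pp. 1924–1927 (Thm. 2.1 p. 1925, Cor. 2.2 and proof p. 1926), §5 pp. 1936–1938, §11 pp. 1976–1978, §12 pp. 1978–1982, Appendix pp. 1982–1983
  (held `paper:doi-10-4007-annals-2012-176-3-9`).
* [KottwitzShelstad1999] R. Kottwitz, D. Shelstad, *Foundations of twisted endoscopy*, Astérisque 255 (1999): §2.1 (endoscopic data), §2.2
  (z-pairs), §§3.3, 5.4 (strongly `θ`-regular, norms), Th. 4.6.A (canonical relative factor), Th. 5.1.D — print's [KS99].
* [Bouaziz1994IntegralesOrbitales] A. Bouaziz, *Intégrales orbitales sur les groupes de Lie réductifs*, ASENS (4) 27 (1994), Thm. 6.2.1 p. 592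
  (★ `RepresentationTheory.Bouaziz1994.OrbitalIntegralsCharacterisation`) — print's [Bou94].
* [Renard2003] D. Renard, *Twisted endoscopy for real groups*, J. Inst. Math. Jussieu 2 (2003), §5.3 — print's [Ren03] (not held).
* [LanglandsShelstad1987] R. Langlands, D. Shelstad, *On the definition of transfer factors*, Math. Ann. 278 (1987), §1.3 — print's [LS87].
* [Shelstad1982] D. Shelstad, *L-indistinguishability for real groups*, Math. Ann. 259 (1982) (★ `Shelstad1982.TransferAndLifting`) — print's [She82].
-/

universe u v

namespace Literature.NumberTheory.Automorphic.Shelstad2012.GeometricTransfer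

/-! ## §1 — the dictionary `TwistedTransferSetting G H₁` -/

/-- **The data of §§1–2** (data only; no field asserts a proposition).  `G` stands for `G(ℝ)`, the real points of a connected reductive
algebraic group `G` over `ℝ`, and `H₁` for `H₁(ℝ)`, where: `θ` is an `ℝ`-automorphism of `G` and `ϖ` a character on `G(ℝ)` attached to a
1-cocycle `a_ϖ` of `W_{ℂ/ℝ}` in the centre of `G^∨` (p. 1920, p. 1921 «[Bor79, 10.1]»); `(G, θ, ψ)` is an inner twist of the quasi-split
`(G*, θ*)` (p. 1920); `e = (H, ℋ, s)` is a set of endoscopic data for `(G, θ, a_ϖ)` [KS99, §2.1] with a z-pair `(H₁, ξ₁)` [KS99, Chap. 2]: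
«`H₁` is quasi-split over `ℝ` with simply-connected derived group, and there is an exact sequence `1 → Z₁ → H₁ → H → 1` defined over `ℝ`,
where `Z₁` is an induced central torus in `H₁`.  Then `H₁(ℝ) → H(ℝ)` is surjective … `ξ₁` determines, in particular, a character `ϖ₁` on
`Z₁(ℝ)`» (p. 1921); until §12 «the norm correspondence involves no twisting of the conjugacy classes in `H₁(ℝ)`» (p. 1924).  Fields:
`theta` = `θ` on `G(ℝ)`; `varpi` = `ϖ`; `Z₁` = `Z₁(ℝ) = Ker(H₁(ℝ) → H(ℝ))` (p. 1921); `varpi₁` = `ϖ₁`; `schwartzθ` = `𝒞(G(ℝ), θ)`, the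
`θ`-Schwartz functions: «To a smooth complex-valued function `f` on `G(ℝ)` we attach the smooth function `f_θ` on `G(ℝ)θ` given by
`f_θ(xθ) = f(x)`.  We call `f` a `θ`-Schwartz function on `G(ℝ)` if `f_θ` is Schwartz on `G(ℝ)θ`» (p. 1922, Appendix pp. 1982–1983);
`testθ` = `C_c^∞(G(ℝ), θ)`: «`f ∈ C_c^∞(G(ℝ), θ)`, by which we mean that `f_θ` lies in `C_c^∞(G(ℝ)θ)`» (p. 1925); `schwartz₁` = `𝒞(H₁(ℝ), ϖ₁)`,
«the space … of functions that are `ϖ₁`-Schwartz in the usual sense» (p. 1922); `test₁` = `C_c^∞(H₁(ℝ), ϖ₁)` (p. 1925); `IsStrThetaReg δ` = «`δ`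
is strongly `θ`-regular» [KS99, §3.3] (p. 1922: «Then the `θ`-twisted centralizer `Cent_θ(δ, G)` of `δ` is reductive and abelian, but is not
necessarily connected»); `IsStrGReg γ₁` = «`γ₁ ∈ H₁(ℝ)` is strongly `G`-regular» (p. 1922; «The ordinary centralizer `Cent(γ₁, H₁)` is a torus»);
`IsNorm γ₁ δ` = «`γ₁` is a norm of `δ`» in the sense of [KS99, §§3.3, 5.4], «the norm correspondence for `G(ℝ)` and `H₁(ℝ)` attached to `θ`»
(pp. 1922, 1924; §6 p. 1938: «If the class of strongly `θ`-regular `δ` in `G(ℝ)` corresponds to the class of strongly `G`-regular `γ₁` in `H₁(ℝ)`,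
then `γ₁` is a norm of `δ`»); `twOrb δ f` = `O^{θ,ϖ}(δ, f) = ∫_{Cent_θ(δ,G)(ℝ)\G(ℝ)} f(g⁻¹ δ θ(g)) ϖ(g) dg/dt_δ`, «the well-defined `(θ, ϖ)`-twisted
orbital integral» for `f ∈ 𝒞(G(ℝ), θ)` and strongly `θ`-regular `δ`, with the FIXED Haar measure `dg` on `G(ℝ)` and the measures `dt_δ` on the
`Cent_θ(δ, G)(ℝ)` COMPATIBLE with the `dt_{γ₁}` in the sense of §11 (p. 1923 display, pp. 1977–1978; values at other `(δ, f)` are never used);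
`stOrb γ₁ f₁` = «the familiar stable orbital integral `SO(γ₁, f₁)` … defined for `f₁ ∈ 𝒞(H₁(ℝ), ϖ₁)` and the quotient measure `dh₁/dt_{γ₁}`»
(p. 1923; fixed `dh₁`); `Delta γ₁ δ` = «the transfer factor `Δ(γ₁, δ)` from [KS99] (see also [KS12])» in some normalization («the choice of
normalization does not matter for existence of the transfer identity», p. 1924); `stTempChar` = «the space of stable tempered characters on
`H₁(ℝ)`» (p. 1925), as functionals `f₁ ↦ Θ(f₁)` on the functions on `H₁(ℝ)` (values off `𝒞(H₁(ℝ), ϖ₁)` never used).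
[cite: Shelstad2012, §1 pp. 1920–1923; §2 pp. 1924–1925; §11 pp. 1977–1978; Appendix pp. 1982–1983] -/
structure TwistedTransferSetting (G : Type u) (H₁ : Type v) [Group G] [Group H₁] where
  /-- `θ` restricted to `G(ℝ)` (p. 1920). -/
  theta : G ≃* G
  /-- The twisting character `ϖ` of `G(ℝ)` (p. 1920). -/
  varpi : G →* ℂˣ
  /-- `Z₁(ℝ) = Ker(H₁(ℝ) → H(ℝ))`, central (p. 1921). -/
  Z₁ : Subgroup H₁
  /-- The character `ϖ₁` on `Z₁(ℝ)` determined by `ξ₁` (p. 1921). -/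
  varpi₁ : ↥Z₁ →* ℂˣ
  /-- `𝒞(G(ℝ), θ)`, the `θ`-Schwartz functions on `G(ℝ)` (p. 1922). -/
  schwartzθ : Submodule ℂ (G → ℂ)
  /-- `C_c^∞(G(ℝ), θ)` (p. 1925). -/
  testθ : Submodule ℂ (G → ℂ)
  /-- `𝒞(H₁(ℝ), ϖ₁)`, the `ϖ₁`-Schwartz functions on `H₁(ℝ)` (p. 1922). -/
  schwartz₁ : Submodule ℂ (H₁ → ℂ)
  /-- `C_c^∞(H₁(ℝ), ϖ₁)` (p. 1925). -/
  test₁ : Submodule ℂ (H₁ → ℂ)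
  /-- «strongly `θ`-regular» elements of `G(ℝ)` [KS99, §3.3] (p. 1922). -/
  IsStrThetaReg : G → Prop
  /-- «strongly `G`-regular» elements of `H₁(ℝ)` (p. 1922). -/
  IsStrGReg : H₁ → Prop
  /-- «`γ₁` is a norm of `δ`» [KS99, §§3.3, 5.4] (pp. 1922, 1938). -/
  IsNorm : H₁ → G → Prop
  /-- `(δ, f) ↦ O^{θ,ϖ}(δ, f)` (p. 1923), compatible measures (§11). -/
  twOrb : G → (G → ℂ) → ℂ
  /-- `(γ₁, f₁) ↦ SO(γ₁, f₁)` (p. 1923). -/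
  stOrb : H₁ → (H₁ → ℂ) → ℂ
  /-- `(γ₁, δ) ↦ Δ(γ₁, δ)`, the transfer factor of [KS99] (p. 1923). -/
  Delta : H₁ → G → ℂ
  /-- The stable tempered characters on `H₁(ℝ)` (p. 1925). -/
  stTempChar : Set ((H₁ → ℂ) → ℂ)

namespace TwistedTransferSetting

variable {G : Type u} {H₁ : Type v} [Group G] [Group H₁] (D : TwistedTransferSetting G H₁)

/-- **`θ`-conjugacy in `G(ℝ)`** (p. 1922: «On `G(ℝ)θ` there is an action of `G(ℝ)` by conjugation: `xθ.g = g⁻¹(xθ)g = g⁻¹ x θ(g) θ`»; p. 1923 the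
integrand `f(g⁻¹ δ θ(g))`; p. 1925 «The summation is over `θ`-conjugacy classes»): `δ′` is `θ`-conjugate to `δ` iff `δ′ = g⁻¹ δ θ(g)` for some
`g ∈ G(ℝ)`. [cite: Shelstad2012, §1 p. 1922; §2 p. 1925] -/
def IsTwistedConj (δ δ' : G) : Prop :=
  ∃ g : G, δ' = g⁻¹ * δ * D.theta g

/-- **The `θ`-twisted centralizer `Cent_θ(δ, G)(ℝ)`** (its real points: the stabiliser of `δθ` for the action of p. 1922), `{g ∈ G(ℝ) ∣ g⁻¹ δ θ(g) = δ}`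
— the group integrated out in `O^{θ,ϖ}(δ, f)` (p. 1923). [cite: Shelstad2012, §1 pp. 1922–1923] -/
def twistedCentralizer (δ : G) : Set G :=
  {g : G | g⁻¹ * δ * D.theta g = δ}

/-- **The transformation law under `Z₁(ℝ)`** (p. 1922 display): «we require that a test function `f₁` on `H₁(ℝ)` satisfy `f₁(z₁h₁) = ϖ₁(z₁)⁻¹ f₁(h₁)`
for all `z₁ ∈ Z₁(ℝ)`, `h₁ ∈ H₁(ℝ)`». [cite: Shelstad2012, §1 p. 1922] -/
def IsVarpiEquivariant (f₁ : H₁ → ℂ) : Prop :=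
  ∀ (z : ↥D.Z₁) (h : H₁), f₁ ((z : H₁) * h) = (((D.varpi₁ z)⁻¹ : ℂˣ) : ℂ) * f₁ h

/-- **§1, the z-pair conventions for the data** (p. 1921 «`Z₁` is an induced central torus in `H₁`»; p. 1922 display; p. 1922 «On `H₁(ℝ)` we consider
the space `𝒞(H₁(ℝ), ϖ₁)` of functions that are `ϖ₁`-Schwartz»; p. 1925 «`f₁ ∈ C_c^∞(H₁(ℝ), ϖ₁)`»): `Z₁(ℝ)` is central in `H₁(ℝ)`, and the functions of
`𝒞(H₁(ℝ), ϖ₁)` and of `C_c^∞(H₁(ℝ), ϖ₁)` transform by `ϖ₁⁻¹` under translation by `Z₁(ℝ)`. [cite: Shelstad2012, §1 pp. 1921–1922; §2 p. 1925] -/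
def Shelstad2012_1_zPairSpaces : Prop :=
  (∀ z ∈ D.Z₁, ∀ h : H₁, z * h = h * z) ∧
    (∀ f₁ ∈ D.schwartz₁, D.IsVarpiEquivariant f₁) ∧ ∀ f₁ ∈ D.test₁, D.IsVarpiEquivariant f₁

/-- **§1 p. 1922**: «Because `δ` has a norm in `H₁(ℝ)`, `ϖ` is trivial on `Cent_θ(δ, G)(ℝ)`; see [KS99], where we use Theorem 5.1.D to strengthen
Lemma 4.4.C» — for strongly `θ`-regular `δ ∈ G(ℝ)` with a (strongly `G`-regular) norm `γ₁ ∈ H₁(ℝ)` (the fact that makes the integrand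
`f(g⁻¹δθ(g)) ϖ(g)` of `O^{θ,ϖ}(δ, f)` left `Cent_θ(δ, G)(ℝ)`-invariant, p. 1923). [cite: Shelstad2012, §1 p. 1922] [cite: KottwitzShelstad1999, Th. 5.1.D; Lemma 4.4.C] -/
def Shelstad2012_1_varpiTrivialOnTwistedCentralizer : Prop :=
  ∀ δ : G, D.IsStrThetaReg δ → (∃ γ₁ : H₁, D.IsStrGReg γ₁ ∧ D.IsNorm γ₁ δ) →
    ∀ g ∈ D.twistedCentralizer δ, D.varpi g = 1

/-! ## §2 — the `Δ`-weighted sum of twisted orbital integrals, `Trans(f)` and `Trans_c(f)` -/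

/-- **The `θ`-conjugacy classes of strongly `θ`-regular elements in `G(ℝ)`** (p. 1925: «The summation is over `θ`-conjugacy classes of strongly
`θ`-regular elements in `G(ℝ)`»): the quotient of `{δ ∈ G(ℝ) ∣ δ strongly θ-regular}` by `θ`-conjugacy. [cite: Shelstad2012, §2 p. 1925] -/
abbrev TwistedClass : Type u :=
  Quot (fun a b : {δ : G // D.IsStrThetaReg δ} => D.IsTwistedConj a.1 b.1)

/-- **The summand `Δ(γ₁, δ) O^{θ,ϖ}(δ, f)` as a function of the `θ`-conjugacy class of `δ`**, evaluated at a representative (p. 1925: «for fixed `γ₁`,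
the product `Δ(γ₁, δ) O^{θ,ϖ}(δ, f)` depends only on the `θ`-conjugacy class of strongly `θ`-regular `δ`» — the named row
`Shelstad2012_2_sumOverClasses`; same device as ★ `Rogawski1990.IsDeltaTransferRel`). [cite: Shelstad2012, §2 p. 1925] -/
noncomputable def summandRep (γ₁ : H₁) (f : G → ℂ) (c : D.TwistedClass) : ℂ :=
  D.Delta γ₁ (Quot.out c).1 * D.twOrb (Quot.out c).1 f

/-- **The right side of the transfer identity** (pp. 1924–1925 display): `Σ_{δ, θ-conj} Δ(γ₁, δ) O^{θ,ϖ}(δ, f)`, «The summation is over `θ`-conjugacy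
classes of strongly `θ`-regular elements in `G(ℝ)`; … nonvanishing on finitely many such classes (see Section 5)» — a finitely supported sum over
`TwistedClass` (`finsum`; print's finiteness is the row `Shelstad2012_2_sumOverClasses`). [cite: Shelstad2012, §2 pp. 1924–1925] -/
noncomputable def deltaWeightedSum (γ₁ : H₁) (f : G → ℂ) : ℂ :=
  ∑ᶠ c : D.TwistedClass, D.summandRep γ₁ f c

/-- **§2 p. 1925, the sum is a finite sum over classes**: «for fixed `γ₁`, the product `Δ(γ₁, δ) O^{θ,ϖ}(δ, f)` depends only on the `θ`-conjugacy class
of strongly `θ`-regular `δ` and is nonvanishing on finitely many such classes (see Section 5)» — for `f ∈ 𝒞(G(ℝ), θ)` and strongly `G`-regular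
`γ₁ ∈ H₁(ℝ)`. [cite: Shelstad2012, §2 p. 1925; §5 p. 1938] -/
def Shelstad2012_2_sumOverClasses : Prop :=
  ∀ f ∈ D.schwartzθ, ∀ γ₁ : H₁, D.IsStrGReg γ₁ →
    (∀ δ δ' : G, D.IsStrThetaReg δ → D.IsStrThetaReg δ' → D.IsTwistedConj δ δ' →
        D.Delta γ₁ δ * D.twOrb δ f = D.Delta γ₁ δ' * D.twOrb δ' f) ∧
      (Function.support (D.summandRep γ₁ f)).Finite

/-- **§5 pp. 1937–1938, the sum is over the `θ`-classes with norm `γ₁`**: «Here we declare the contribution of the class of `δ` to be zero if `γ₁` is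
not a norm of `δ`» (p. 1937) and «The set of elements with `γ₁` as norm forms a single stable `θ`-conjugacy class of elements in `G(ℝ)` … Thus the
summation in `Φ₁(γ₁)` may be taken over the (finite) set of `θ`-conjugacy classes in this stable class» (p. 1938) — for `f ∈ 𝒞(G(ℝ), θ)` and
strongly `G`-regular `γ₁`: the contribution of the class of a strongly `θ`-regular `δ` of which `γ₁` is not a norm vanishes, and the classes of the
`δ` with norm `γ₁` are finitely many. [cite: Shelstad2012, §5 pp. 1937–1938] -/
def Shelstad2012_5_sumOverNormClasses : Prop :=
  ∀ f ∈ D.schwartzθ, ∀ γ₁ : H₁, D.IsStrGReg γ₁ →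
    (∀ δ : G, D.IsStrThetaReg δ → ¬ D.IsNorm γ₁ δ → D.Delta γ₁ δ * D.twOrb δ f = 0) ∧
      {c : D.TwistedClass | ∃ δ : {δ : G // D.IsStrThetaReg δ}, Quot.mk _ δ = c ∧ D.IsNorm γ₁ δ.1}.Finite

/-- **The matching of one pair `(f, f₁)`** (pp. 1924–1925 display): «`SO(γ₁, f₁) = Σ_{δ, θ-conj} Δ(γ₁, δ) O^{θ,ϖ}(δ, f)` for all strongly `G`-regular `γ₁`
in `H₁(ℝ)`» — `f` and `f₁` «have `Δ`-matching orbital integrals» (p. 1925). [cite: Shelstad2012, §2 pp. 1924–1925] -/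
def IsDeltaMatching (f : G → ℂ) (f₁ : H₁ → ℂ) : Prop :=
  ∀ γ₁ : H₁, D.IsStrGReg γ₁ → D.stOrb γ₁ f₁ = D.deltaWeightedSum γ₁ f

/-- **`Trans(f)`** (p. 1924): «Define the subset `Trans(f)` of `𝒞(H₁(ℝ), ϖ₁)` to consist of those `ϖ₁`-Schwartz functions `f₁` on `H₁(ℝ)` whose
strongly `G`-regular stable orbital integrals match, through the norm correspondence for `G(ℝ)` and `H₁(ℝ)` attached to `θ`, `Δ`-weighted
combinations of `(θ, ϖ)`-twisted orbital integrals of `f`: `SO(γ₁, f₁) = Σ_{δ, θ-conj} Δ(γ₁, δ) O^{θ,ϖ}(δ, f)` for all strongly `G`-regular `γ₁` in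
`H₁(ℝ)`» (defined for `f ∈ 𝒞(G(ℝ), θ)`). [cite: Shelstad2012, §2 pp. 1924–1925] -/
def transferSet (f : G → ℂ) : Set (H₁ → ℂ) :=
  {f₁ : H₁ → ℂ | f₁ ∈ D.schwartz₁ ∧ D.IsDeltaMatching f f₁}

/-- **`Trans_c(f)`** (p. 1925): «We may consider instead `f ∈ C_c^∞(G(ℝ), θ)` … and define the set `Trans_c(f)` of functions `f₁ ∈ C_c^∞(H₁(ℝ), ϖ₁)`
such that `f` and `f₁` have `Δ`-matching orbital integrals in the same manner.» [cite: Shelstad2012, §2 p. 1925] -/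
def transferSetc (f : G → ℂ) : Set (H₁ → ℂ) :=
  {f₁ : H₁ → ℂ | f₁ ∈ D.test₁ ∧ D.IsDeltaMatching f f₁}

/-- **§2 p. 1925, the embeddings of the test spaces**: «Embedding `C_c^∞(G(ℝ), θ)` in `𝒞(G(ℝ), θ)`, we may adapt the argument above», and
`C_c^∞(H₁(ℝ), ϖ₁) ⊆ 𝒞(H₁(ℝ), ϖ₁)` (the `f₁` of Cor. 2.2 is compared with `f₁⁰ ∈ Trans(f)` through `SO`, p. 1926) — for the data: the two
compactly supported spaces are contained in the two Schwartz spaces. [cite: Shelstad2012, §2 pp. 1925–1926] -/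
def Shelstad2012_2_testFunctionsEmbed : Prop :=
  D.testθ ≤ D.schwartzθ ∧ D.test₁ ≤ D.schwartz₁

/-- **§2 p. 1925, `Δ` vanishes off the norms**: «This transfer identity for the pair `(f, f₁)` says, in particular, that if strongly `G`-regular `γ₁`
is not a norm, then `SO(γ₁, f₁) = 0` since, by definition, we then have `Δ(γ₁, δ) = 0` for all strongly `θ`-regular `δ` in `G(ℝ)`» — TYPED: the
cited fact about [KS99]'s `Δ`: a strongly `G`-regular `γ₁` that is a norm of no strongly `θ`-regular `δ` has `Δ(γ₁, δ) = 0` for every strongly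
`θ`-regular `δ` (whence `SO(γ₁, f₁) = 0` for `f₁ ∈ Trans(f)`, a consequence of the definitions not restated as a row). [cite: Shelstad2012, §2 p. 1925] -/
def Shelstad2012_2_deltaZeroOffNorms : Prop :=
  ∀ γ₁ : H₁, D.IsStrGReg γ₁ → (∀ δ : G, D.IsStrThetaReg δ → ¬ D.IsNorm γ₁ δ) →
    ∀ δ : G, D.IsStrThetaReg δ → D.Delta γ₁ δ = 0

/-- **The annihilator in `𝒞(H₁(ℝ), ϖ₁)` of the space of stable tempered characters on `H₁(ℝ)`** (p. 1925). [cite: Shelstad2012, §2 p. 1925] -/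
def stableAnnihilator : Set (H₁ → ℂ) :=
  {g : H₁ → ℂ | g ∈ D.schwartz₁ ∧ ∀ Θ ∈ D.stTempChar, Θ g = 0}

/-- **The annihilator in `C_c^∞(H₁(ℝ), ϖ₁)` of the space of all stable tempered characters on `H₁(ℝ)`** (p. 1925). [cite: Shelstad2012, §2 p. 1925] -/
def stableAnnihilatorc : Set (H₁ → ℂ) :=
  {g : H₁ → ℂ | g ∈ D.test₁ ∧ ∀ Θ ∈ D.stTempChar, Θ g = 0}

/-- **§2 p. 1925, uniqueness of the transfer modulo the annihilator**: «Notice that `f₁ ∈ Trans(f)` is determined uniquely modulo the annihilator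
in `𝒞(H₁(ℝ), ϖ₁)` of the space of stable tempered characters on `H₁(ℝ)`» (argued from the density of the strongly `G`-regular elements,
Harish-Chandra's regularity theorem [HC75, §11, Th. 1] and a stable Weyl integration formula: «`f₁` and `f₂` agree on such characters»), and «we
may adapt the argument above to see that `f₁ ∈ Trans_c(f)` is determined uniquely modulo the annihilator in `C_c^∞(H₁(ℝ), ϖ₁)` of the space of
all stable tempered characters on `H₁(ℝ)`» — TYPED: two members of `Trans(f)` (`f ∈ 𝒞(G(ℝ), θ)`), resp. of `Trans_c(f)` (`f ∈ C_c^∞(G(ℝ), θ)`), differ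
by an element of the respective annihilator.  (So the correspondence `(f, f₁)` «determines a map from `𝒞(G(ℝ), θ)` to the quotient of
`𝒞(H₁(ℝ), ϖ₁)` by the annihilator of stable tempered characters», p. 1925.) [cite: Shelstad2012, §2 p. 1925] -/
def Shelstad2012_2_transferUniqueModAnnihilator : Prop :=
  (∀ f ∈ D.schwartzθ, ∀ f₁ ∈ D.transferSet f, ∀ f₂ ∈ D.transferSet f, f₁ - f₂ ∈ D.stableAnnihilator) ∧
    ∀ f ∈ D.testθ, ∀ f₁ ∈ D.transferSetc f, ∀ f₂ ∈ D.transferSetc f, f₁ - f₂ ∈ D.stableAnnihilatorc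

/-! ## §2 — THEOREM 2.1 and COROLLARY 2.2 -/

/-- **THEOREM 2.1 (Main Theorem) (p. 1925).**  «For all `f ∈ 𝒞(G(ℝ), θ)`, the subset `Trans(f)` of `𝒞(H₁(ℝ), ϖ₁)` is nonempty.»  (p. 1925: «We
conclude from this theorem that the correspondence `(f, f₁)`, where `f ∈ 𝒞(G(ℝ), θ)` and `f₁ ∈ Trans(f)`, is well defined.»  Proved in §§3–11;
extended to slightly twisted norms by THEOREM 12.2, p. 1982.)  In standard endoscopy (`θ = 1`, `ϖ = 1`, `(H₁, ξ₁) = (H, ξ¹)`) this is the Schwartz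
transfer `f ↦ f^H` of [Shelstad1982, (3.1.1), (3.6)] (★ `Shelstad1982.TransferAndLifting.TransferSetting.IsTransferFactorFamily`), see the module
docstring. [cite: Shelstad2012, Thm. 2.1 (p. 1925)] -/
def Shelstad2012_2_1_mainTheorem : Prop :=
  ∀ f ∈ D.schwartzθ, (D.transferSet f).Nonempty

/-- **COROLLARY 2.2 (p. 1926).**  «There is an analogue for `C_c^∞`-functions.  Corollary 2.2.  For all `f ∈ C_c^∞(G(ℝ), θ)`, the subset `Trans_c(f)`
is nonempty.»  Print's PROOF (p. 1926): «Let `f ∈ C_c^∞(G(ℝ), θ)`.  Using the main theorem we first find `f₁⁰` in the subset `Trans(f)` of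
`𝒞(H₁(ℝ), ϖ₁)`» (`Shelstad2012_2_1_mainTheorem` through `Shelstad2012_2_testFunctionsEmbed`); «Then because the stable orbital integrals of `f₁⁰`
vanish off the conjugacy classes meeting a set in `H₁(ℝ)` that is bounded modulo `Z₁(ℝ)`» (`Shelstad2012_2_2_proof_boundedModCentre`), «Bouaziz's
characterization of stable orbital integrals of `C_c^∞`-functions shows that there exists `f₁ ∈ C_c^∞(H₁(ℝ), ϖ₁)` such that `SO(γ₁, f₁) = SO(γ₁, f₁⁰)`
for all strongly `G`-regular `γ₁` in `H₁(ℝ)`.  Here, a slight extension of [Bou94, Th. 6.2.1] is needed; see [Ren03, §5.3]»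
(`Shelstad2012_2_2_proof_bouazizStep`).  «Then `f₁ ∈ Trans_c(f)`» (by the definitions of `Trans`, `Trans_c`).  This is the `C_c^∞` transfer «`f^H` of
compact support» that ★ `Rogawski1990` cites at the real place (§4.9 Prop. 4.9.1 (a) p. 55) and the road of the H413 organs `stub_N9bouazizReplacement`
∕ `stub_N8bouaziz` (★ `Rogawski1990.ArchBouazizReplacement`). [cite: Shelstad2012, Cor. 2.2 (p. 1926)] -/
def Shelstad2012_2_2_compactSupport : Prop :=
  ∀ f ∈ D.testθ, (D.transferSetc f).Nonempty

/-! ## §2 — the printed proof of COROLLARY 2.2 (p. 1926) -/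

section ProofOfCorollary

variable [TopologicalSpace H₁]

/-- **«A set in `H₁(ℝ)` that is bounded modulo `Z₁(ℝ)`»** (p. 1926; cf. THEOREM 12.1 p. 1981 «the orbits of some set `Z₁(ℝ)B`, where `B` is a bounded
subset»): `A ⊆ Z₁(ℝ)·K` for some compact `K ⊆ H₁(ℝ)` («bounded» in the Lie group `H₁(ℝ)` = relatively compact). [cite: Shelstad2012, Cor. 2.2 proof (p. 1926); Thm. 12.1 (p. 1981)] -/
def IsBoundedModCentre (A : Set H₁) : Prop :=
  ∃ K : Set H₁, IsCompact K ∧ ∀ a ∈ A, ∃ z ∈ D.Z₁, ∃ k ∈ K, a = z * k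

/-- **«The stable orbital integrals of `f₁` vanish off the conjugacy classes meeting `A`»** (p. 1926): `SO(γ₁, f₁) = 0` for every strongly `G`-regular
`γ₁ ∈ H₁(ℝ)` no `H₁(ℝ)`-conjugate of which lies in `A` (print's `SO(γ₁, ·)` enters the transfer only at strongly `G`-regular `γ₁`, pp. 1924–1925).
[cite: Shelstad2012, Cor. 2.2 proof (p. 1926)] -/
def StOrbVanishOffClassesMeeting (f₁ : H₁ → ℂ) (A : Set H₁) : Prop :=
  ∀ γ₁ : H₁, D.IsStrGReg γ₁ → (∀ γ' : H₁, IsConj γ₁ γ' → γ' ∉ A) → D.stOrb γ₁ f₁ = 0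

/-- **Proof of COROLLARY 2.2, first step (p. 1926)**: for `f ∈ C_c^∞(G(ℝ), θ)` and `f₁⁰ ∈ Trans(f)`, «the stable orbital integrals of `f₁⁰` vanish off
the conjugacy classes meeting a set in `H₁(ℝ)` that is bounded modulo `Z₁(ℝ)`» (because `SO(γ₁, f₁⁰) = Σ_δ Δ(γ₁, δ) O^{θ,ϖ}(δ, f)`, `f_θ` has compact
support and the `δ` with norm `γ₁` form one stable `θ`-conjugacy class, §5 p. 1938).  The «bounded `Δ″`-side» organ of the H413 lines (★
`Rogawski1990.ArchTransferSideBounded`, ★ `…ArchInnerTransferSideCompact`, where `Z(H_∞)` is compact and «bounded modulo `Z₁(ℝ)`» is «relatively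
compact»). [cite: Shelstad2012, Cor. 2.2 proof (p. 1926)] -/
def Shelstad2012_2_2_proof_boundedModCentre : Prop :=
  ∀ f ∈ D.testθ, ∀ f₀ ∈ D.transferSet f,
    ∃ A : Set H₁, D.IsBoundedModCentre A ∧ D.StOrbVanishOffClassesMeeting f₀ A

/-- **Proof of COROLLARY 2.2, second step (p. 1926) — Bouaziz's characterization, slightly extended**: for `f₁⁰ ∈ 𝒞(H₁(ℝ), ϖ₁)` whose stable
orbital integrals «vanish off the conjugacy classes meeting a set in `H₁(ℝ)` that is bounded modulo `Z₁(ℝ)`, Bouaziz's characterization of stable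
orbital integrals of `C_c^∞`-functions shows that there exists `f₁ ∈ C_c^∞(H₁(ℝ), ϖ₁)` such that `SO(γ₁, f₁) = SO(γ₁, f₁⁰)` for all strongly
`G`-regular `γ₁` in `H₁(ℝ)`.  Here, a slight extension of [Bou94, Th. 6.2.1] is needed; see [Ren03, §5.3]» (in print's own apparatus: the second
sentence of THEOREM 12.1, p. 1981, at `G = H₁`, `g₀ = 1`, p. 1977).  The vanishing hypothesis is taken at the strongly `G`-regular points, where
alone `Trans(f)` constrains `SO(·, f₁⁰)` (they are dense in the regular semisimple set, p. 1925, and `γ ↦ SO(γ, f₁⁰)` is smooth on each regular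
Cartan).  This is the letter of ★ `Rogawski1990.ArchBouazizReplacement` and the «`C_c^∞`-transfer» input ★
`Bouaziz1994.OrbitalIntegralsCharacterisation.Bouaziz1994_6_2_1_i_surjective` ∕ `…Bouaziz1994_6_Rem2_testFunctionTransfer`.
[cite: Shelstad2012, Cor. 2.2 proof (p. 1926); Thm. 12.1 (p. 1981)] [cite: Bouaziz1994IntegralesOrbitales, Thm. 6.2.1 (p. 592)] [cite: Renard2003, §5.3] -/
def Shelstad2012_2_2_proof_bouazizStep : Prop :=
  ∀ f₀ ∈ D.schwartz₁, (∃ A : Set H₁, D.IsBoundedModCentre A ∧ D.StOrbVanishOffClassesMeeting f₀ A) →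
    ∃ f₁ ∈ D.test₁, ∀ γ₁ : H₁, D.IsStrGReg γ₁ → D.stOrb γ₁ f₁ = D.stOrb γ₁ f₀

end ProofOfCorollary

end TwistedTransferSetting

end Literature.NumberTheory.Automorphic.Shelstad2012.GeometricTransfer
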